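import Literature.AnabelianGeometry.SemiGraphs.ProfiniteSemiGraphHomComp
import Literature.AnabelianGeometry.SemiGraphs.TemperedSpecialFibreReductions
import Literature.AnabelianGeometry.SemiGraphs.TemperedVerticialNamedFactsProofs
import Literature.AnabelianGeometry.SemiGraphs.TemperedReconstructionR2bProofs
import HarnessLib

/-!
# [SemiAnbd] Corollary 3.11, «functorial with respect to `γ`»: identity, composition and
# `γ`-EQUIVARIANCE of the reconstructed isomorphism of special-fibre semi-graphs, from the typed
# uniqueness clause

Mochizuki, *Semi-graphs of anabelioids*, Publ. RIMS **42** (2006), §3, Corollary 3.11, manuscript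
pp. 45–46: «any isomorphism of topological groups `γ : Δ[α] ⥲ Δ[β]` determines a compatible isomorphism of
semi-graphs of anabelioids `𝒢^c[α] ⥲ 𝒢^c[β]` in a fashion that is functorial with respect to `γ`»
[cite: MochizukiSemiAnbd2006, Cor 3.11 pp.45-46]; proof p. 47 (i) and §6 Thm. 6.5 (iii) p. 72 l. 14
«Assertion (iii) follows from Corollary 3.11» [cite: MochizukiSemiAnbd2006, Thm 6.5(iii) p.72].

The tree types Cor. 3.11 as the named fact `Cor311` (`TemperedSpecialFibre.lean`, FACT-LIST F-1721,
FACT-policy) whose functoriality clause is UNIQUENESS of the underlying isomorphism of semi-graphs among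
the `γ`-compatible ones (`Cor311Compatible`).  This PROOF-ONLY file (abc-iut cell, seat abc-iut-L3-d2
gen 6, row «COR311-EQUIVARIANCE⟸FUNCTORIALITY»; no `def`, no instance, no new named fact) unpacks that
clause into the functoriality print asserts, over the composition of 1-morphisms
`ProfiniteSemiGraph.Hom.comp` (`ProfiniteSemiGraphHomComp.lean`):

* `Hom.IsIso.comp`, `Hom.IsIso.identity` — isomorphisms of semi-graphs of anabelioids compose;
* `SpecialFibreData.ChartCompatible.comp` / `Cor311Compatible.comp` / `.congr` / `.identity` —
  `γ`-compatibilities COMPOSE (`γ ↦ γ ≫ γ'`, the intermediate verticial homomorphism supplied by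
  Prop. 3.2 / Thm. 3.7 (i) existence, PROVED in the tree: `exists_isVerticialHom`), respect pointwise
  equality of `γ`, and the identity is compatible with `γ = id` (Prop. 3.2 conjugacy of verticial
  homomorphisms, abc-iut's `exists_conj_of_isVerticialHom`);
* `cor311_base_eq_of_compatible` — F-1721's uniqueness clause as pairwise equality of underlying maps;
* ★ `cor311_base_identity` — the isomorphism reconstructed from `γ = id` is the identity on the
  underlying semi-graph; ★ `cor311_base_comp` — the one reconstructed from `γ ≫ γ'` is the composite on
  underlying semi-graphs (three certified special fibres); ★ `cor311_base_equivariant` — for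
  `σ : Δ[α] ⥲ Δ[α]`, `τ : Δ[β] ⥲ Δ[β]` with `γ ∘ σ = τ ∘ γ` and compatible self-isomorphisms `A` over
  `σ`, `B` over `τ`, the `γ`-compatible isomorphism `F` satisfies `F ∘ A = B ∘ F` on vertices and on
  edges — with `σ = inn(g)|`, `τ = inn(γ̃ g)|` this is verbatim clause (3) («`F_i ∘ inn(g) = inn(γ g) ∘ F_i`
  on `𝔾^c_i`») of the binder `hLG` of abc-iut-L3-t11's `TemperedCuspidalAbsolutenessOfProCusps.lean`
  (row F-1704, Thm. 6.5 (iii)), now DERIVED from F-1721 at the level fibres; `cor311_exists_equivariant`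
  packages existence + equivariance.

HONEST LIMITS.  `Cor311` (F-1721) is a NAMED HYPOTHESIS throughout (FACT-policy; nothing is asserted for
any curve); what the equivariance theorem leaves displayed is exactly the banked junction (L3-lead β61):
(α) the level special fibres must be CERTIFIED `SpecialFibreData` (`Ω.IsSpecialFibreOf`), (β′) the
`Π^temp`-action on `𝔾^c_i` must be through Cor-3.11-compatible self-isomorphisms over the inner
automorphisms.  Nothing here takes a side on [IUTchIII] Cor. 3.12; typed ≠ proved.
-/

noncomputable section

open CategoryTheory Topology

namespace Literature.AnabelianGeometry.SemiGraphs

universe u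

/-! ### Isomorphisms of semi-graphs of anabelioids compose -/

namespace ProfiniteSemiGraph

variable {𝒢 ℋ 𝒦 : ProfiniteSemiGraph.{u}}

/-- Isomorphisms of semi-graphs of anabelioids (local presentation) compose.
[cite: MochizukiSemiAnbd2006, Def 2.2(ii) p.24] -/
theorem Hom.IsIso.comp {F : Hom 𝒢 ℋ} {G : Hom ℋ 𝒦} (hF : F.IsIso) (hG : G.IsIso) :
    (F.comp G).IsIso where
  bijective_vertexMap := hG.bijective_vertexMap.comp hF.bijective_vertexMap
  bijective_edgeMap := hG.bijective_edgeMap.comp hF.bijective_edgeMap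
  abuts_none b hb := hG.abuts_none _ (hF.abuts_none b hb)
  isLocallyTrivial := hF.isLocallyTrivial.comp hG.isLocallyTrivial

/-- The identity morphism is an isomorphism of semi-graphs of anabelioids.
[cite: MochizukiSemiAnbd2006, Def 2.2(ii) p.24] -/
theorem Hom.IsIso.identity (𝒢 : ProfiniteSemiGraph.{u}) : (Hom.identity 𝒢).IsIso where
  bijective_vertexMap := Function.bijective_id
  bijective_edgeMap := Function.bijective_id
  abuts_none _ hb := hb
  isLocallyTrivial := Hom.identity_isLocallyTrivial 𝒢

end ProfiniteSemiGraph

open ProfiniteSemiGraph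

/-! ### `γ`-compatibilities compose -/

section Compatible

variable {Kα : Type u} [Field Kα] {Kβ : Type u} [Field Kβ] {Kγ : Type u} [Field Kγ]
  {Dα : TemperedArithmeticGroup Kα} {Dβ : TemperedArithmeticGroup Kβ}
  {Dγ : TemperedArithmeticGroup Kγ}
  {Sα : SpecialFibreData Dα} {Sβ : SpecialFibreData Dβ} {Sγ : SpecialFibreData Dγ}

/-- **Chart-compatibilities compose**: if `φ` is compatible with `F : 𝒢^c[α] ⥲ 𝒢^c[β]` and `ψ` with
`G : 𝒢^c[β] ⥲ 𝒢^c[γ]` (up to conjugation, against the verticial homomorphisms), then `ψ ∘ φ` is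
compatible with `G ∘ F` — the intermediate verticial homomorphism at `F v` exists by Thm. 3.7 (i)
(`exists_isVerticialHom`, proved), and the two conjugators paste to `ψ(g₁) · g₂`.
[cite: MochizukiSemiAnbd2006, Cor 3.11 p.46] -/
theorem SpecialFibreData.ChartCompatible.comp {φ : Sα.chart.G ≃ₜ* Sβ.chart.G}
    {ψ : Sβ.chart.G ≃ₜ* Sγ.chart.G} {F : Hom Sα.Gc Sβ.Gc} {G : Hom Sβ.Gc Sγ.Gc}
    (hF : Sα.ChartCompatible Sβ φ F) (hG : Sβ.ChartCompatible Sγ ψ G) :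
    Sα.ChartCompatible Sγ (φ.trans ψ) (F.comp G) := by
  intro v ψα ψγ hψα hψγ
  obtain ⟨ψβ, hψβ⟩ := exists_isVerticialHom Sβ.hyp.isQuasiCoherent Sβ.hyp.isGaloisCountable
    Sβ.chart (F.base.vertexMap v)
  obtain ⟨g₁, hg₁⟩ := hF v ψα ψβ hψα hψβ
  obtain ⟨g₂, hg₂⟩ := hG (F.base.vertexMap v) ψβ ψγ hψβ hψγ
  refine ⟨ψ g₁ * g₂, fun x => ?_⟩
  change ψ (φ (ψα x)) = _
  rw [hg₁ x, map_mul, map_mul, map_inv, hg₂ (F.hV v x), Hom.comp_hV_apply, mul_inv_rev]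
  simp only [mul_assoc]
  rfl

/-- **Cor. 3.11-compatibilities compose**: `F` compatible with `γ` and `G` compatible with `γ'` give
`G ∘ F` compatible with `γ' ∘ γ` (the descended isomorphisms of the tempered fundamental groups of the
special fibres compose over the admissible quotients). [cite: MochizukiSemiAnbd2006, Cor 3.11 p.46] -/
theorem Cor311Compatible.comp {γ : Dα.delta ≃ₜ* Dβ.delta} {γ' : Dβ.delta ≃ₜ* Dγ.delta}
    {F : Hom Sα.Gc Sβ.Gc} {G : Hom Sβ.Gc Sγ.Gc} (hF : Cor311Compatible Sα Sβ γ F)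
    (hG : Cor311Compatible Sβ Sγ γ' G) : Cor311Compatible Sα Sγ (γ.trans γ') (F.comp G) := by
  obtain ⟨φ, hφ, hFc⟩ := hF
  obtain ⟨ψ, hψ, hGc⟩ := hG
  refine ⟨φ.trans ψ, fun x => ?_, SpecialFibreData.ChartCompatible.comp hFc hGc⟩
  change ψ (φ (Sα.admissible x)) = Sγ.admissible (γ' (γ x))
  rw [hφ, hψ]

/-- Cor. 3.11-compatibility only depends on `γ` through its values. [cite: MochizukiSemiAnbd2006, Cor 3.11 p.46] -/
theorem Cor311Compatible.congr {γ₁ γ₂ : Dα.delta ≃ₜ* Dβ.delta} {F : Hom Sα.Gc Sβ.Gc}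
    (h : ∀ x, γ₁ x = γ₂ x) (hF : Cor311Compatible Sα Sβ γ₁ F) : Cor311Compatible Sα Sβ γ₂ F := by
  obtain ⟨φ, hφ, hFc⟩ := hF
  exact ⟨φ, fun x => (hφ x).trans (by rw [h x]), hFc⟩

/-- **The identity is compatible with `γ = id`**: `φ = id` lies over the admissible quotient, and two
verticial homomorphisms at the same vertex are conjugate (Prop. 3.2).
[cite: MochizukiSemiAnbd2006, Cor 3.11 p.46] -/
theorem Cor311Compatible.identity (Sα : SpecialFibreData Dα) :
    Cor311Compatible Sα Sα (ContinuousMulEquiv.refl Dα.delta) (Hom.identity Sα.Gc) := by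
  refine ⟨ContinuousMulEquiv.refl _, fun _ => rfl, fun v ψα ψβ hψα hψβ => ?_⟩
  obtain ⟨g, hg⟩ := exists_conj_of_isVerticialHom Sα.chart ψα ψβ hψα hψβ
  refine ⟨g⁻¹, fun x => ?_⟩
  have key : ψβ ((Hom.identity Sα.Gc).hV v x) = g * ψα x * g⁻¹ := (hg x).symm
  rw [key, inv_inv]
  change ψα x = g⁻¹ * (g * ψα x * g⁻¹) * g
  simp [mul_assoc]

end Compatible

/-! ### Functoriality of Cor. 3.11 in `γ`, from the uniqueness clause of `Cor311` (F-1721 BY NAME) -/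

section Functoriality

variable {Kα : Type u} [Field Kα] {Kβ : Type u} [Field Kβ] {Kγ : Type u} [Field Kγ]
  (pα pβ pγ : ℕ) [Fact pα.Prime] [Fact pβ.Prime] [Fact pγ.Prime]
  [Algebra ℚ_[pα] Kα] [FiniteDimensional ℚ_[pα] Kα] [Algebra ℚ_[pβ] Kβ] [FiniteDimensional ℚ_[pβ] Kβ]
  [Algebra ℚ_[pγ] Kγ] [FiniteDimensional ℚ_[pγ] Kγ]
  (Ωα : SpecialFibreOrigin Kα) (Ωβ : SpecialFibreOrigin Kβ) (Ωγ : SpecialFibreOrigin Kγ)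
  {Dα : TemperedArithmeticGroup Kα} {Dβ : TemperedArithmeticGroup Kβ}
  {Dγ : TemperedArithmeticGroup Kγ}
  {Sα : SpecialFibreData Dα} {Sβ : SpecialFibreData Dβ} {Sγ : SpecialFibreData Dγ}

/-- **Uniqueness clause of Cor. 3.11, pairwise**: at certified special fibres, two `γ`-compatible
isomorphisms `𝒢^c[α] ⥲ 𝒢^c[β]` agree on vertices and on edges (F-1721 `Cor311` BY NAME).
[cite: MochizukiSemiAnbd2006, Cor 3.11 pp.45-46] -/
theorem cor311_base_eq_of_compatible (h311 : Cor311 pα pβ Ωα Ωβ)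
    (hSα : Ωα.IsSpecialFibreOf Dα Sα) (hSβ : Ωβ.IsSpecialFibreOf Dβ Sβ) (γ : Dα.delta ≃ₜ* Dβ.delta)
    {F₁ F₂ : Hom Sα.Gc Sβ.Gc} (h₁ : F₁.IsIso) (c₁ : Cor311Compatible Sα Sβ γ F₁) (h₂ : F₂.IsIso)
    (c₂ : Cor311Compatible Sα Sβ γ F₂) :
    F₁.base.vertexMap = F₂.base.vertexMap ∧ F₁.base.edgeMap = F₂.base.edgeMap := by
  obtain ⟨⟨F₀, -, -, hu⟩, -⟩ := h311 Dα Dβ Sα Sβ hSα hSβ γ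
  obtain ⟨a₁, b₁⟩ := hu F₁ h₁ c₁
  obtain ⟨a₂, b₂⟩ := hu F₂ h₂ c₂
  exact ⟨a₁.trans a₂.symm, b₁.trans b₂.symm⟩

/-- **Functoriality at `γ = id`**: at a certified special fibre, every isomorphism of `𝒢^c[α]`
compatible with the identity of `Δ[α]` is the IDENTITY on the underlying semi-graph (F-1721 at
`(α, α)` BY NAME). [cite: MochizukiSemiAnbd2006, Cor 3.11 pp.45-46] -/
theorem cor311_base_identity (h311 : Cor311 pα pα Ωα Ωα) (hSα : Ωα.IsSpecialFibreOf Dα Sα)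
    {A : Hom Sα.Gc Sα.Gc} (hA : A.IsIso)
    (hAc : Cor311Compatible Sα Sα (ContinuousMulEquiv.refl Dα.delta) A) :
    A.base.vertexMap = id ∧ A.base.edgeMap = id :=
  cor311_base_eq_of_compatible pα pα Ωα Ωα h311 hSα hSα _ hA hAc (Hom.IsIso.identity Sα.Gc)
    (Cor311Compatible.identity Sα)

/-- **Functoriality under composition**: at certified special fibres, if `F` is compatible with `γ`,
`G` with `γ'` and `H` with `γ' ∘ γ`, then `H = G ∘ F` on the underlying semi-graphs (F-1721 at
`(α, γ)` BY NAME). [cite: MochizukiSemiAnbd2006, Cor 3.11 pp.45-46] -/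
theorem cor311_base_comp (h311 : Cor311 pα pγ Ωα Ωγ) (hSα : Ωα.IsSpecialFibreOf Dα Sα)
    (hSγ : Ωγ.IsSpecialFibreOf Dγ Sγ) {γ : Dα.delta ≃ₜ* Dβ.delta} {γ' : Dβ.delta ≃ₜ* Dγ.delta}
    {F : Hom Sα.Gc Sβ.Gc} (hF : F.IsIso) (hFc : Cor311Compatible Sα Sβ γ F)
    {G : Hom Sβ.Gc Sγ.Gc} (hG : G.IsIso) (hGc : Cor311Compatible Sβ Sγ γ' G)
    {H : Hom Sα.Gc Sγ.Gc} (hH : H.IsIso) (hHc : Cor311Compatible Sα Sγ (γ.trans γ') H) :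
    H.base.vertexMap = G.base.vertexMap ∘ F.base.vertexMap ∧
      H.base.edgeMap = G.base.edgeMap ∘ F.base.edgeMap :=
  cor311_base_eq_of_compatible pα pγ Ωα Ωγ h311 hSα hSγ _ hH hHc (hF.comp hG) (hFc.comp hGc)

/-- ★ **`γ`-EQUIVARIANCE of the Cor. 3.11 isomorphism** («functorial with respect to `γ`», pp. 45–46;
clause (3) of the Thm. 6.5 (iii) binder `hLG`): at certified special fibres `𝒢^c[α]`, `𝒢^c[β]`, let
`F : 𝒢^c[α] ⥲ 𝒢^c[β]` be compatible with `γ : Δ[α] ⥲ Δ[β]`, `A : 𝒢^c[α] ⥲ 𝒢^c[α]` compatible with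
`σ : Δ[α] ⥲ Δ[α]` and `B : 𝒢^c[β] ⥲ 𝒢^c[β]` compatible with `τ : Δ[β] ⥲ Δ[β]`, where `γ ∘ σ = τ ∘ γ`
(e.g. `σ = inn(g)|_{Δ[α]}`, `τ = inn(γ̃ g)|_{Δ[β]}`).  Then `F ∘ A = B ∘ F` on vertices and on edges —
both composites are compatible with `γ ∘ σ = τ ∘ γ`, so F-1721's uniqueness clause (BY NAME) applies.
[cite: MochizukiSemiAnbd2006, Cor 3.11 pp.45-46] -/
theorem cor311_base_equivariant (h311 : Cor311 pα pβ Ωα Ωβ) (hSα : Ωα.IsSpecialFibreOf Dα Sα)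
    (hSβ : Ωβ.IsSpecialFibreOf Dβ Sβ) {γ : Dα.delta ≃ₜ* Dβ.delta} {σ : Dα.delta ≃ₜ* Dα.delta}
    {τ : Dβ.delta ≃ₜ* Dβ.delta} (hστ : ∀ x, γ (σ x) = τ (γ x))
    {F : Hom Sα.Gc Sβ.Gc} (hF : F.IsIso) (hFc : Cor311Compatible Sα Sβ γ F)
    {A : Hom Sα.Gc Sα.Gc} (hA : A.IsIso) (hAc : Cor311Compatible Sα Sα σ A)
    {B : Hom Sβ.Gc Sβ.Gc} (hB : B.IsIso) (hBc : Cor311Compatible Sβ Sβ τ B) :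
    F.base.vertexMap ∘ A.base.vertexMap = B.base.vertexMap ∘ F.base.vertexMap ∧
      F.base.edgeMap ∘ A.base.edgeMap = B.base.edgeMap ∘ F.base.edgeMap :=
  cor311_base_eq_of_compatible pα pβ Ωα Ωβ h311 hSα hSβ (σ.trans γ) (hA.comp hF) (hAc.comp hFc)
    (hF.comp hB) ((hFc.comp hBc).congr fun x => (hστ x).symm)

/-- The equivariance, pointwise on edges (the shape of clause (3) of `hLG`: `F (g · e) = γ(g) · F e`).
[cite: MochizukiSemiAnbd2006, Cor 3.11 pp.45-46] -/
theorem cor311_edgeMap_equivariant (h311 : Cor311 pα pβ Ωα Ωβ) (hSα : Ωα.IsSpecialFibreOf Dα Sα)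
    (hSβ : Ωβ.IsSpecialFibreOf Dβ Sβ) {γ : Dα.delta ≃ₜ* Dβ.delta} {σ : Dα.delta ≃ₜ* Dα.delta}
    {τ : Dβ.delta ≃ₜ* Dβ.delta} (hστ : ∀ x, γ (σ x) = τ (γ x))
    {F : Hom Sα.Gc Sβ.Gc} (hF : F.IsIso) (hFc : Cor311Compatible Sα Sβ γ F)
    {A : Hom Sα.Gc Sα.Gc} (hA : A.IsIso) (hAc : Cor311Compatible Sα Sα σ A)
    {B : Hom Sβ.Gc Sβ.Gc} (hB : B.IsIso) (hBc : Cor311Compatible Sβ Sβ τ B)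
    (e : Sα.Gc.graph.Edge) :
    F.base.edgeMap (A.base.edgeMap e) = B.base.edgeMap (F.base.edgeMap e) :=
  congrFun (cor311_base_equivariant pα pβ Ωα Ωβ h311 hSα hSβ hστ hF hFc hA hAc hB hBc).2 e

/-- The equivariance, pointwise on vertices. [cite: MochizukiSemiAnbd2006, Cor 3.11 pp.45-46] -/
theorem cor311_vertexMap_equivariant (h311 : Cor311 pα pβ Ωα Ωβ) (hSα : Ωα.IsSpecialFibreOf Dα Sα)
    (hSβ : Ωβ.IsSpecialFibreOf Dβ Sβ) {γ : Dα.delta ≃ₜ* Dβ.delta} {σ : Dα.delta ≃ₜ* Dα.delta}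
    {τ : Dβ.delta ≃ₜ* Dβ.delta} (hστ : ∀ x, γ (σ x) = τ (γ x))
    {F : Hom Sα.Gc Sβ.Gc} (hF : F.IsIso) (hFc : Cor311Compatible Sα Sβ γ F)
    {A : Hom Sα.Gc Sα.Gc} (hA : A.IsIso) (hAc : Cor311Compatible Sα Sα σ A)
    {B : Hom Sβ.Gc Sβ.Gc} (hB : B.IsIso) (hBc : Cor311Compatible Sβ Sβ τ B)
    (v : Sα.Gc.graph.Vertex) :
    F.base.vertexMap (A.base.vertexMap v) = B.base.vertexMap (F.base.vertexMap v) :=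
  congrFun (cor311_base_equivariant pα pβ Ωα Ωβ h311 hSα hSβ hστ hF hFc hA hAc hB hBc).1 v

/-- ★ **Existence AND equivariance, packaged** (the printed «determines a compatible isomorphism … in
a fashion that is functorial with respect to `γ`»): at certified special fibres and for every `γ`,
F-1721 (BY NAME) yields an isomorphism `F` compatible with `γ` which is equivariant against EVERY pair
of compatible self-isomorphisms `A / σ`, `B / τ` intertwined by `γ`.
[cite: MochizukiSemiAnbd2006, Cor 3.11 pp.45-46] -/
theorem cor311_exists_equivariant (h311 : Cor311 pα pβ Ωα Ωβ) (hSα : Ωα.IsSpecialFibreOf Dα Sα)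
    (hSβ : Ωβ.IsSpecialFibreOf Dβ Sβ) (γ : Dα.delta ≃ₜ* Dβ.delta) :
    ∃ F : Hom Sα.Gc Sβ.Gc, F.IsIso ∧ Cor311Compatible Sα Sβ γ F ∧
      ∀ (σ : Dα.delta ≃ₜ* Dα.delta) (τ : Dβ.delta ≃ₜ* Dβ.delta), (∀ x, γ (σ x) = τ (γ x)) →
        ∀ (A : Hom Sα.Gc Sα.Gc), A.IsIso → Cor311Compatible Sα Sα σ A →
        ∀ (B : Hom Sβ.Gc Sβ.Gc), B.IsIso → Cor311Compatible Sβ Sβ τ B →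
          F.base.vertexMap ∘ A.base.vertexMap = B.base.vertexMap ∘ F.base.vertexMap ∧
            F.base.edgeMap ∘ A.base.edgeMap = B.base.edgeMap ∘ F.base.edgeMap := by
  obtain ⟨⟨F, hF, hFc, -⟩, -⟩ := h311 Dα Dβ Sα Sβ hSα hSβ γ
  exact ⟨F, hF, hFc, fun σ τ hστ A hA hAc B hB hBc =>
    cor311_base_equivariant pα pβ Ωα Ωβ h311 hSα hSβ hστ hF hFc hA hAc hB hBc⟩

end Functoriality

end Literature.AnabelianGeometry.SemiGraphs

end
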